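/-
Copyright: b2b-lace packet (enumeration shard B, gen 10).  The WEIGHT half of the dictionary between the
nineteen end-point classes `Stage1Cells.V` of the recursion layer and the lattice point classes: the record's
weight `V.normSq v` IS `‖x‖₂²` at every point of the class `pointClass d 5 (V.profile d v)` (whose cardinality is
`V.orbit d v`, `LatticePointClassesRec.card_pointClass_profile`), and a `W_d`-invariant function sums over the
class to `V.orbit d v • g x₀`.  Pure combinatorics over the tree's own definitions; no numerals beyond the class
table already in the tree; no cell is changed; nothing of the record is touched.
-/
import Literature.Probability.FitznerVanDerHofstad2017.LatticePointClassesRegroup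
import Literature.Probability.FitznerVanDerHofstad2017.LatticePointClassesRec
import HarnessLib

/-!
# The record's class weights are Euclidean norms (`V.normSq v = ‖x‖₂²` on the class of `v`)

CITATION HEADER (PLACEMENT v2). This module is part of a certified REPRODUCTION of:
R. Fitzner, R. van der Hofstad, *Mean-field behavior for nearest-neighbor percolation in d > 10*,
Electron. J. Probab. 22 (2017), no. 43, 1–65 [FvdH17], and *Generalized approach to the non-backtracking
lace expansion*, Probab. Theory Related Fields 169 (2017), 1041–1119 [NoBLE17-I] (arXiv:1506.07977, 1506.07969).
Reproduces: nothing new of the source — it LINKS things already in the tree: the computable class table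
`Stage1Cells.V.mult / npts / orbit / normSq` of `Stage1CellsRec` (by which the weighted-bubble cell OF RECORD
regroups "the sum over all `x ∈ ℤ^d`" of [NoBLE17-I] §5.3.3 into nineteen end-point classes, D46-SPEC F2/F4),
the class-cardinality dictionary `LatticePointClassesRec.card_pointClass_profile` (`#class = V.orbit d v`,
carver-g18) and the regrouping module `LatticePointClassesRegroup` (`W_d`-transitivity on classes,
`Σ_μ |x_μ|² = Σ_j N_j j²` on a class).  Result: for every class `v` and every point `x` of
`pointClass d 5 (V.profile d v)`, `euclidNorm x ^ 2 = V.normSq v` (the record's weight `‖v‖₂²` of D46-SPEC F4 is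
the Euclidean norm squared the source's `H_z(x) = ‖x‖₂² G_z(x)` carries); membership by the NON-ZERO profile
alone; and `Σ_{x ∈ class(v)} g x = V.orbit d v • g x₀` for `W_d`-invariant `g`.  Origin: build `lace`, node
N67-W⁺/W2 (c) of `LEMMAS.md` §24 (feeds N67-S2/S3; licenses reading the record cell's `orbit · normSq · (…)` terms
as class sums of `‖x‖₂² (…)` without touching the cell).

## What is here

* `V.sum_profile_succ_mul_sq` — `Σ_{j=1}^{5} N_j j² = V.normSq v` (nineteen cases, `decide`); `V.npts_le_five`;
* `Stage1Cells.mem_pointClass_profile_iff_tail` — membership by levels `≤ 5` and `N₁, …, N₅` alone (no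
  hypothesis `k ≤ d`: the zero count is forced);
* **`Stage1Cells.sum_natAbs_sq_of_mem_pointClass_profile`**, **`Stage1Cells.euclidNorm_sq_of_mem_pointClass_profile`**
  — `Σ_μ |x_μ|² = V.normSq v` and `euclidNorm x ^ 2 = V.normSq v` on the class;
* **`Stage1Cells.sum_pointClass_profile_eq`** — `Σ_{x ∈ class(v)} g x = V.orbit d v • g x₀` for
  `SignedPermInvariant g`, `k ≤ d`, `x₀` in the class.

## What is NOT here

No walk counts, no evaluation, no change to any cell; `Stage1CellsRec` and `LatticePointClassesRec` are
imported, never edited; the record modules (`MeanFieldD11*`, `NobleInstantiate`) are untouched.  No cited fact,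
no named hypothesis, no `sorry`.

## References
* [NoBLE17-I] R. Fitzner, R. van der Hofstad, Generalized approach to the non-backtracking lace expansion,
  Probab. Theory Relat. Fields 169 (2017) 1041–1119; arXiv:1506.07969 — §5.3.3 (`H_z(x) = ‖x‖₂² G_z(x)`, the
  sum over `x ∈ ℤ^d`).
* [FvdH17] notebooks (Percolation.nb cells 5–24, class notation) as transcribed in `Stage1CellsRec`.
-/

namespace Literature.Probability.FitznerVanDerHofstad2017
namespace Stage1Cells

open Finset Literature.Probability.LatticeModels Literature.Barriers.CriticalPhenomena

variable {d : ℕ}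

/-- `Σ_{j=1}^{5} N_j · j² = ‖v‖₂² = V.normSq v` for each of the nineteen classes. [folklore] -/
theorem V.sum_profile_succ_mul_sq (d : ℕ) (v : V) :
    ∑ j : Fin 5, V.profile d v j.succ * ((j : ℕ) + 1) ^ 2 = v.normSq := by
  simp only [V.profile_succ]
  cases v <;> decide

/-- The classes of record have at most five non-zero coordinates (so every `d ≥ 5` carries all of them).
[folklore] -/
theorem V.npts_le_five (v : V) : v.npts ≤ 5 := by cases v <;> decide

/-- Membership by the NON-ZERO profile: `x` lies in the class of `v` iff its levels are `≤ 5` and it has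
`(V.mult v)_j` coordinates of absolute value `j` for `j = 1, …, 5` — the number `d − k` of zero coordinates is
then forced (and `k ≤ d` follows). [folklore] -/
theorem mem_pointClass_profile_iff_tail (v : V) {x : Site d} :
    x ∈ pointClass d 5 (V.profile d v) ↔
      (∀ μ, (x μ).natAbs ≤ 5) ∧ ∀ j : Fin 5, absCount x ((j : ℕ) + 1) = v.mult.getD j 0 := by
  rw [mem_pointClass]
  refine and_congr_right fun hr => ⟨fun h j => by simpa using h j.succ, fun h j => ?_⟩
  refine Fin.cases ?_ (fun j => by simpa using h j) j
  have hsum := sum_absCount_eq_of_mem_absBox (r := 5) (mem_absBox.2 hr)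
  rw [Fin.sum_univ_succ] at hsum
  simp only [Fin.val_zero, Fin.val_succ] at hsum
  rw [sum_congr rfl (fun j _ => h j)] at hsum
  have hk := V.sum_profile_succ d v
  simp only [V.profile_succ] at hk
  rw [hk] at hsum
  simp only [Fin.val_zero, V.profile_zero]
  omega

/-- `Σ_μ |x_μ|² = V.normSq v` at every point of the class of `v`. [folklore] -/
theorem sum_natAbs_sq_of_mem_pointClass_profile (v : V) {x : Site d} (hx : x ∈ pointClass d 5 (V.profile d v)) :
    ∑ μ, (x μ).natAbs ^ 2 = v.normSq := by
  rw [sum_natAbs_sq_of_mem_pointClass hx, Fin.sum_univ_succ]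
  simp only [Fin.val_zero, Fin.val_succ]
  rw [V.sum_profile_succ_mul_sq]
  simp

/-- **`‖x‖₂² = V.normSq v` on the class of `v`**: the record's weight (D46-SPEC F4) is the Euclidean norm squared
of every point of the class. [cite: FitznerVanDerHofstad2016NoBLE, §5.3.3 (H_z(x) = ‖x‖₂² G_z(x))] -/
theorem euclidNorm_sq_of_mem_pointClass_profile (v : V) {x : Site d}
    (hx : x ∈ pointClass d 5 (V.profile d v)) : euclidNorm x ^ 2 = v.normSq := by
  rw [euclidNorm_sq_eq_natCast, sum_natAbs_sq_of_mem_pointClass_profile v hx]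

/-- **Class sum of a `W_d`-invariant function over a class of record**: `Σ_{x ∈ class(v)} g x = |O_d(v)| • g x₀`
with `|O_d(v)| = V.orbit d v`. [cite: FitznerVanDerHofstad2016NoBLE, §5.3.3 (the sum over all x ∈ ℤ^d regrouped by symmetry)] -/
theorem sum_pointClass_profile_eq {β : Type*} [AddCommMonoid β] {g : Site d → β} (hg : SignedPermInvariant g)
    (v : V) (hd : v.npts ≤ d) {x₀ : Site d} (hx₀ : x₀ ∈ pointClass d 5 (V.profile d v)) :
    ∑ x ∈ pointClass d 5 (V.profile d v), g x = V.orbit d v • g x₀ := by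
  rw [hg.sum_pointClass_eq hx₀, card_pointClass_profile v hd]

end Stage1Cells
end Literature.Probability.FitznerVanDerHofstad2017
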